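import Summits.CriticalPhenomena.PercolationContinuityZ3.Theorems.PercNearOneGluingNoHeavyPcintClusterExploration
import Summits.CriticalPhenomena.PercolationContinuityZ3.Theorems.PercNearOneGluingNoHeavyPcintKingPairs
import HarnessLib

/-!
# PCINT lane, king route, K1 step (2L): van den Berg–Ermakov's `ξ`-process on a finite box and its `∗`-paths

Cell `prim-pcint`, seat `prim-pcint-1` (gen 9); memo `run/shared/lean/prim/pcint/KING-ROUTE.md` §K1 (2L).

The second process of `AdaptDom.expect_le_of_dominating` in the king route: on a finite set `Λ ⊆ ℤ²` of
square-lattice sites with root `o`, the sample space is the set of PAIR STATES `w : Λ → Bool × Bool`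
(the states of the two `ℤ²∗`-sites `KingPairs.pairSite v false/true` of each `v ∈ Λ`), and the oracle
`outVdBE` reports, when the exploration rule `ClusterExpl.rule` (root first, then the unrevealed
`Λ`-neighbours of the selected revealed-true site `b`) examines a site `a`:

* at the root step, `ξ(o) = [w o ≠ (0,0)]` (some site of the pair of `o` is open);
* afterwards, `ξ(a) = [a is ε-adjacent to b]` (`KingPairs.EtaAdj` in the `ℤ²∗`-configuration `cfg w` of
  open pair sites) — van den Berg–Ermakov, Random Struct. Alg. 8 (1996), §3.

Results: `boxGraph` (the square lattice induced on `Λ`), `cfg`, `outVdBE`;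
`etaChain_of_run_eq_some_true` — every site revealed TRUE by the `ξ`-run is joined to `o` by a chain of
`ε`-adjacent sites of `Λ`, and the pair of `o` has an open site; hence (`exists_pathIn_star_of_run_eq_some_true`,
with `KingPairs`) an OPEN `∗`-PATH in `cfg w` from an open site of the pair of `o` to an open site of the pair of
that site; and `exists_pathIn_star_of_reach` — if the payoff `ClusterExpl.reachIndicator` of the final
`ξ`-state is `1` for a target set `B`, such a path reaches the pair of a site of `B`.
-/

noncomputable section

namespace Summit.CriticalPhenomena.PercolationContinuityZ3.Theorems.Pcint

namespace VdBEProcess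

open Finset AdaptDom ClusterExpl KingPairs Literature.Probability.Percolation Literature.Probability.LatticeModels

variable (Λ : Finset (Site 2))

/-- The square lattice induced on the finite set `Λ`. -/
def boxGraph : SimpleGraph ↥Λ := SimpleGraph.comap (fun v : ↥Λ => v.1) (zdGraph 2)

/-- Adjacency in the box graph is lattice adjacency of the underlying sites. -/
theorem boxGraph_adj {a b : ↥Λ} : (boxGraph Λ).Adj a b ↔ (zdGraph 2).Adj a.1 b.1 := Iff.rfl

/-- Adjacency in the box graph is decidable (it is lattice adjacency). -/
instance instDecidableRelBoxGraphAdj : DecidableRel (boxGraph Λ).Adj := fun a b =>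
  inferInstanceAs (Decidable ((zdGraph 2).Adj a.1 b.1))

/-- The `ℤ²∗`-site configuration of a pair-state assignment: the open pair sites. -/
def cfg (w : ↥Λ → Bool × Bool) : Set (Site 2) :=
  {s | ∃ v : ↥Λ, (s = pairSite v.1 false ∧ (w v).1 = true) ∨ (s = pairSite v.1 true ∧ (w v).2 = true)}

variable {Λ}

/-- The bottom site of the pair of `v` is open iff the first bit of `w v` is set. -/
theorem pairSite_false_mem_cfg {w : ↥Λ → Bool × Bool} {v : ↥Λ} : pairSite v.1 false ∈ cfg Λ w ↔ (w v).1 = true := by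
  constructor
  · rintro ⟨u, ⟨h, hu⟩ | ⟨h, hu⟩⟩
    · have := pairSite_injective (a₁ := (v.1, false)) (a₂ := (u.1, false)) h
      simp only [Prod.mk.injEq, and_true] at this
      rw [Subtype.ext this]; exact hu
    · have := pairSite_injective (a₁ := (v.1, false)) (a₂ := (u.1, true)) h
      simp at this
  · intro h; exact ⟨v, Or.inl ⟨rfl, h⟩⟩

/-- The top site of the pair of `v` is open iff the second bit of `w v` is set. -/
theorem pairSite_true_mem_cfg {w : ↥Λ → Bool × Bool} {v : ↥Λ} : pairSite v.1 true ∈ cfg Λ w ↔ (w v).2 = true := by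
  constructor
  · rintro ⟨u, ⟨h, hu⟩ | ⟨h, hu⟩⟩
    · have := pairSite_injective (a₁ := (v.1, true)) (a₂ := (u.1, false)) h
      simp at this
    · have := pairSite_injective (a₁ := (v.1, true)) (a₂ := (u.1, true)) h
      simp only [Prod.mk.injEq, and_true] at this
      rw [Subtype.ext this]; exact hu
  · intro h; exact ⟨v, Or.inr ⟨rfl, h⟩⟩

/-- A pair with a nonzero state has an open site. -/
theorem exists_pairSite_mem_cfg {w : ↥Λ → Bool × Bool} {v : ↥Λ} (h : w v ≠ (false, false)) :
    ∃ i : Bool, pairSite v.1 i ∈ cfg Λ w := by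
  cases h1 : (w v).1
  · cases h2 : (w v).2
    · exact absurd (Prod.ext h1 h2) h
    · exact ⟨true, pairSite_true_mem_cfg.2 h2⟩
  · exact ⟨false, pairSite_false_mem_cfg.2 h1⟩

/-- `ε`-adjacent sites both have an open pair site. -/
theorem exists_pairSite_mem_of_etaAdj {ω : Set (Site 2)} {u v : Site 2} (h : EtaAdj ω u v) :
    ∃ j : Bool, pairSite v j ∈ ω := by
  obtain ⟨a, b, -, hb, -⟩ := exists_adj_open_of_etaAdj h
  exact ⟨b, hb⟩

variable (Λ) (enc : ↥Λ → ℕ) (o : ↥Λ)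

open Classical in
/-- **van den Berg–Ermakov's oracle**: at the root step report `[w o ≠ (0,0)]`; afterwards report whether the
examined site is `ε`-adjacent (in `cfg w`) to the selected site. -/
def outVdBE (w : ↥Λ → Bool × Bool) (σ : ↥Λ → Option Bool) (a : ↥Λ) : Bool :=
  if ∀ v, σ v = none then decide (w a ≠ (false, false))
  else match sel (boxGraph Λ) enc σ with
    | none => false
    | some b => decide (EtaAdj (cfg Λ w) a.1 b.1)

variable {Λ enc o}

/-- **Every site revealed true is `ε`-chained to the root**: along the `ξ`-run, if `v` is revealed true after `n`
steps then the pair of `o` has an open site and `v` is joined to `o` by a chain of `ε`-adjacent sites of `Λ`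
(each revealed-true site is `ε`-adjacent to the site that examined it). -/
theorem etaChain_of_run_eq_some_true (w : ↥Λ → Bool × Bool) :
    ∀ (n : ℕ) (v : ↥Λ), run (rule (boxGraph Λ) enc o) (outVdBE Λ enc w) n v = some true →
      w o ≠ (false, false) ∧ Relation.ReflTransGen (fun a b : ↥Λ => EtaAdj (cfg Λ w) a.1 b.1) o v
  | 0, v, hv => by simp [run] at hv
  | n + 1, v, hv => by
    set τ := run (rule (boxGraph Λ) enc o) (outVdBE Λ enc w) n with hτ
    change stepPA (rule (boxGraph Λ) enc o τ) τ (outVdBE Λ enc w τ) v = some true at hv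
    unfold stepPA at hv
    by_cases hvR : v ∈ rule (boxGraph Λ) enc o τ
    · rw [if_pos hvR, Option.some.injEq] at hv
      -- `v` is examined at this step and reports `true`
      unfold outVdBE at hv
      by_cases hinit : ∀ u, τ u = none
      · -- root step: `v = o`
        rw [if_pos hinit, decide_eq_true_eq] at hv
        have hR : rule (boxGraph Λ) enc o τ = {o} := by rw [rule, if_pos hinit]
        rw [hR, mem_singleton] at hvR
        subst hvR
        exact ⟨hv, Relation.ReflTransGen.refl⟩
      · rw [if_neg hinit] at hv
        cases hsel : sel (boxGraph Λ) enc τ with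
        | none => rw [hsel] at hv; simp at hv
        | some b =>
          rw [hsel] at hv
          simp only [decide_eq_true_eq] at hv
          have hb : τ b = some true := (mem_filter.1 (sel_spec (boxGraph Λ) enc hsel).1).2.1
          obtain ⟨ho, hchain⟩ := etaChain_of_run_eq_some_true w n b hb
          exact ⟨ho, hchain.tail (etaAdj_comm.1 hv)⟩
    · rw [if_neg hvR] at hv
      exact etaChain_of_run_eq_some_true w n v hv

/-- **An `ε`-chain from the root gives open `∗`-paths** from every open site of the pair of `o` to every open
site of the pair of its endpoint (`KingPairs.exists_adj_open_of_etaAdj`, `KingPairs.pathIn_pair`). -/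
theorem pathIn_star_of_etaChain {ω : Set (Site 2)} {v : ↥Λ}
    (h : Relation.ReflTransGen (fun a b : ↥Λ => EtaAdj ω a.1 b.1) o v) :
    ∀ i j : Bool, pairSite o.1 i ∈ ω → pairSite v.1 j ∈ ω → PathIn zdStarGraph ω (pairSite o.1 i) (pairSite v.1 j) := by
  induction h with
  | refl => exact fun i j hi hj => pathIn_pair hi hj
  | @tail a b _ hab ih =>
    intro i j hi hj
    obtain ⟨ia, ib, hia, hib, hadj⟩ := exists_adj_open_of_etaAdj hab
    exact ((ih i ia hi hia).trans (PathIn.of_adj hia hib hadj)).trans (pathIn_pair hib hj)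

/-- **Sites revealed true are reached by open `∗`-paths from the pair of the root.** -/
theorem exists_pathIn_star_of_run_eq_some_true (w : ↥Λ → Bool × Bool) {n : ℕ} {v : ↥Λ}
    (hv : run (rule (boxGraph Λ) enc o) (outVdBE Λ enc w) n v = some true) :
    ∃ i j : Bool, pairSite o.1 i ∈ cfg Λ w ∧ pairSite v.1 j ∈ cfg Λ w ∧
      PathIn zdStarGraph (cfg Λ w) (pairSite o.1 i) (pairSite v.1 j) := by
  obtain ⟨ho, hchain⟩ := etaChain_of_run_eq_some_true w n v hv
  obtain ⟨i, hi⟩ := exists_pairSite_mem_cfg ho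
  -- the endpoint has an open pair site: either `v = o` or `v` is `ε`-adjacent to its predecessor
  have hj : ∃ j : Bool, pairSite v.1 j ∈ cfg Λ w := by
    rcases Relation.ReflTransGen.cases_tail hchain with h | ⟨b, -, hbv⟩
    · subst h; exact ⟨i, hi⟩
    · exact exists_pairSite_mem_of_etaAdj hbv
  obtain ⟨j, hj⟩ := hj
  exact ⟨i, j, hi, hj, pathIn_star_of_etaChain hchain i j hi hj⟩

/-- **If the payoff of the final `ξ`-state is `1`, an open `∗`-path joins the pair of the root to the pair of a
target site**: `reachIndicator = 1` for the target set `B` on (any completion of) the state after `|Λ| + 1`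
steps gives `v ∈ B` revealed true (`ClusterExpl.mem_revealedTrue_of_openPath`), hence the `∗`-path. -/
theorem exists_pathIn_star_of_reach (w : ↥Λ → Bool × Bool) (B : Finset ↥Λ) (ω₀ : ↥Λ → Bool)
    (h : reachIndicator (boxGraph Λ) o B
      (merge (run (rule (boxGraph Λ) enc o) (outVdBE Λ enc w) (Fintype.card ↥Λ + 1)) ω₀) = 1) :
    ∃ v ∈ B, ∃ i j : Bool, pairSite o.1 i ∈ cfg Λ w ∧ pairSite v.1 j ∈ cfg Λ w ∧
      PathIn zdStarGraph (cfg Λ w) (pairSite o.1 i) (pairSite v.1 j) := by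
  set σ := run (rule (boxGraph Λ) enc o) (outVdBE Λ enc w) (Fintype.card ↥Λ + 1) with hσ
  have hex : ∃ v ∈ B, OpenPath (boxGraph Λ) o (merge σ ω₀) v := by
    by_contra hne
    unfold reachIndicator at h
    rw [if_neg hne] at h
    exact zero_ne_one h
  obtain ⟨v, hvB, hp⟩ := hex
  have hterm : rule (boxGraph Λ) enc o σ = ∅ := rule_run_card_succ (boxGraph Λ) enc o _
  have ho : σ o ≠ none := run_root_ne_none (boxGraph Λ) enc o _ _ (Nat.le_add_left 1 _)
  have hne : ¬ ∀ u, σ u = none := fun hall => ho (hall o)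
  have hv : σ v = some true := mem_revealedTrue_of_openPath (boxGraph Λ) enc o hne hterm ho hp
  obtain ⟨i, j, hi, hj, hpath⟩ := exists_pathIn_star_of_run_eq_some_true (o := o) w hv
  exact ⟨v, hvB, i, j, hi, hj, hpath⟩

end VdBEProcess

end Summit.CriticalPhenomena.PercolationContinuityZ3.Theorems.Pcint

end
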